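import Summits.HodgeConjecture.HodgeConjecture.Theorems.HeckePrymWeilHeckePrymAnchorsOfDeligneWeilFamilyDecl
import Literature.AlgebraicGeometry.HodgeTheory.WeilFamilyLevelStructureOfPeriodConstructionAtWeilType
import Literature.AlgebraicGeometry.HodgeTheory.WeilFamilyPeriodConstructionAtWeilType
import HarnessLib

/-!
# The route decl `DeligneWeilFamily` from Deligne's period construction AT WEIL-TYPE POINTS (item stmt-HodgeConjecture-16866, route HeckePrymWeil)

Helper for the statement item `DeligneWeilFamily` (stmt-HodgeConjecture-16866; crux `HeckePrymAnchors`,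
stmt-HodgeConjecture-14496, is its corollary by name, `heckePrymAnchors_of_deligneWeilFamilyDecl`), count-neutral:
two theorems (rev. 2: + the by-name sequel, CONDITIONAL on the named fact), no definition, no `sorry`. Written by
the computation cell `pub-hsemireg` (track «S4-PUSH» (iii), seat s4-bridge-2, gen 33; words gen 34–35; rev. 2
drafted by gen 34–35).

In the tree the item is equivalent BY NAME to the Literature named fact `deligne1982_weilFamily_kAction`
(`deligneWeilFamilyDecl_iff_kAction`), which follows from Deligne's level-`n` family
`deligne1982_weilFamily_levelStructure` (M3; `deligne1982_weilFamily_kAction_of_levelStructure`, «`Γ ⊂ SU ⇒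
det_K γ = 1`»), and M3 follows from the WEIL-TYPE period-construction package ALONE
(`deligne1982_weilFamily_levelStructure_of_periodConstructionAtWeilType_only`,
`Literature/AlgebraicGeometry/HodgeTheory/WeilFamilyLevelStructureOfPeriodConstructionAtWeilType`, with Riemann's
theorem / fullness [F] DISCHARGED by `hodgeIso_bettiOne_isogeny`). This file composes the three:

* `deligneWeilFamily_of_periodConstructionAtWeilType` — **[U at Weil-type points] ⟹ `DeligneWeilFamily`** (the
  route decl, by name);
* `deligneWeilFamily_of_deligne1982_weilFamily_periodConstructionAtWeilType` (rev. 2, appended) — the same from the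
  NAMED fact `Literature.AlgebraicGeometry.HodgeTheory.deligne1982_weilFamily_periodConstructionAtWeilType`
  (`HodgeTheory/WeilFamilyPeriodConstructionAtWeilType`, now in the tree), by `exact`: the item is CONDITIONAL on
  exactly that one printed, UNPROVED fact.

The hypothesis is displayed VERBATIM and is TOKEN-FOR-TOKEN (whitespace-normalised) the body of the cell's
named-fact candidate
`Literature.AlgebraicGeometry.HodgeTheory.deligne1982_weilFamily_periodConstructionAtWeilType` (target
`Literature/AlgebraicGeometry/HodgeTheory/WeilFamilyPeriodConstructionAtWeilType.lean`): Deligne's level-`n'`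
algebraic family `Γ∖B → Γ∖X⁺` through `(P, ψ₀, h_K)` — (1) smooth projective over an irreducible smooth
quasi-projective base, closed in `ℙᴺ × S`, `e' : P ≅ 𝒳_{s₀}`; (2) global `√-d` with abelian fibre charts; (4ℓ)
integral level-`n' ≥ 3` structure at `s₀`; (5U) period surjectivity onto `X⁺` of the rational Weil datum; (6) one
rational polarization class — asked only when `(P, ψ₀)` is OF WEIL TYPE `(n, n)` (Prop. 4.4 of [Deligne1982HodgeCycles]
= van Geemen 4.9 — the signature forced by Thm. 4.8's hypothesis (b), a SPLIT `E`-Hermitian form carrying a Riemann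
form, «(b) implies … the equivalent statements of (4.4)», Milne's TeXed ed., p. 32, not conversely; the family of
the proof of Thm. 4.8
is built from the signature-`(n, n)` Hermitian data alone; van Geemen 5.3–5.5, 5.8–5.11 for every discriminant).
Once that name lands the item
follows from it BY NAME in one line (sequel), i.e. the residual of `DeligneWeilFamily` — «Deligne's Weil family»,
KNOWN IN PRINT (grounder note of 2026-08-16 on the item: «LNM 900 Thm. 4.8 and its proof, pp. 47–51» — chunk
numerals of the held text, not printed pages: printed LNM 900 §4 = pp. 49–61, Milne's TeXed ed. rev. 2018
pp. 32–34) — is recorded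
as exactly the printed construction, which the tree does not perform (no moduli of abelian varieties, no
universal family, no Baily–Borel). HONEST FRAMING: nothing here bears on any open case of the Hodge conjecture;
HC / HC_CM / HC_AV are NOT proved; the package stays an UNPROVED hypothesis; no object of the cell is certified.
-/

noncomputable section

-- every declaration of this problem lives in `Summit.HodgeConjecture.HodgeConjecture.…` (summit = sub-problem)
set_option linter.dupNamespace false

open CategoryTheory AlgebraicGeometry Limits MonoidalCategory CartesianMonoidalCategory
open Literature.AlgebraicTopology.SingularHomology
open scoped TensorProduct

namespace Summit.HodgeConjecture.HodgeConjecture.Theorems.HeckePrymWeilLine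

open Literature.AlgebraicGeometry Literature.AlgebraicGeometry.Motives Literature.AlgebraicGeometry.HodgeTheory
open Summit.HodgeConjecture.HodgeConjecture.Theses.HeckePrymWeil

/-- **The route decl `DeligneWeilFamily` (stmt-HodgeConjecture-16866) from Deligne's period construction AT
WEIL-TYPE POINTS.** If, for every complex abelian `2n`-fold `(P, ψ₀)` OF WEIL TYPE `(n, n)` (`ψ₀ ≫ ψ₀ = -d`,
van Geemen 4.9) with a projective embedding and a rational polarization class, Deligne's level-`n'` algebraic
family through `(P, ψ₀, h_K)` exists with its global `√-d`, abelian fibre charts, integral level structure,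
period surjectivity onto `X⁺` and one polarization class ([Deligne1982HodgeCycles], proof of Thm. 4.8:
quadruples `(A₁, θ₁, ν₁, k₁)`, `B → X⁺`, the group `Γ`, `n ≥ 3`, `Γ∖B → Γ∖X⁺` «an algebraic family of abelian
varieties»; Baily–Borel, Borel; [MumfordFogartyKirwan1994] Thm. 7.9–7.10), then the route decl
`DeligneWeilFamily` holds: M3 from the Weil-type package
(`deligne1982_weilFamily_levelStructure_of_periodConstructionAtWeilType_only`, [F] discharged by
`hodgeIso_bettiOne_isogeny`), then the flat Weil section from the integral level-`n'` monodromy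
(`deligne1982_weilFamily_kAction_of_levelStructure`), then the decl by name (`deligneWeilFamilyDecl_iff_kAction`).
The hypothesis IS the restriction to Weil-type points of the package `h` of the tree's unrestricted reduction
`weilFamilies_of_periodConstruction` (and of `weilFamilies_of_periodConstruction_only`), which keeps the
polarization clause (6) — weaker than it, and no Riemann hypothesis [F] is needed here; against the package [U] of
`deligne1982_weilFamily_levelStructure_of_periodConstruction` and of `heckePrymAnchors_of_periodConstruction`
(no datum `a'`, no clause (6)) it has a WEAKER PREMISE and a STRONGER CONCLUSION — incomparable as typed,
clause (6) being discarded on this chain; and it is token-for-token (whitespace-normalised) the body of the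
named-fact candidate `deligne1982_weilFamily_periodConstructionAtWeilType` of the cell `pub-hsemireg`.
CONDITIONAL: the package is an
UNPROVED hypothesis, displayed verbatim; nothing here proves any case of the Hodge conjecture.
[cite: Deligne1982HodgeCycles, §4 Prop. 4.4 and proof of Thm. 4.8 (Milne's TeXed ed., rev. 2018, pp. 32–34; LNM 900 §4)]
[cite: vanGeemen1994HodgeAV, 4.9, 5.3–5.5 and 5.8–5.11] [cite: MumfordFogartyKirwan1994, Thm. 7.9–7.10] -/
theorem deligneWeilFamily_of_periodConstructionAtWeilType
    (h : ∀ (n d : ℕ), 1 ≤ n → 1 ≤ d →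
          ∀ (P : AbelianVariety ℂ) (ψ₀ : P ⟶ P) (e : ProjectiveEmbedding P.X)
            (a : complexBetti (projectiveSpace e.n ℂ) 2),
            P.dim = 2 * n → ψ₀ ≫ ψ₀ = -((d : ℤ) • 𝟙 P) → ∀ (ha : IsRationalClass a) (ha0 : a ≠ 0),
            IsWeilType P ψ₀ n d →
            ∃ (𝒳 S : SchemeOver ℂ) (f : 𝒳 ⟶ S) (g : 𝒳 ⟶ 𝒳) (s₀ : ComplexPoints S)
              (e' : P.X ≅ fiberOver f s₀)
              (Y : ComplexPoints S → AbelianVariety ℂ) (Ψ : ∀ s, Y s ⟶ Y s)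
              (ε : ∀ s, (Y s).X ≅ fiberOver f s) (N : ℕ)
              (ι : 𝒳 ⟶ CategoryTheory.MonoidalCategoryStruct.tensorObj (projectiveSpace N ℂ) S)
              (a' : complexBetti (projectiveSpace N ℂ) 2),
              IsSmoothProjectiveFamily f (2 * n) ∧
              AlgebraicGeometry.IsClosedImmersion ι.left ∧
              ι ≫ CategoryTheory.CartesianMonoidalCategory.snd (projectiveSpace N ℂ) S = f ∧
              IrreducibleSpace S.left ∧ AlgebraicGeometry.Smooth S.hom ∧ IsQuasiProjectiveOver S ∧
              g ≫ f = f ∧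
              (e'.hom ≫ fiberι f s₀) ≫ g = ψ₀.hom.hom.hom ≫ (e'.hom ≫ fiberι f s₀) ∧
              (∀ s, (Y s).dim = 2 * n ∧ Ψ s ≫ Ψ s = -((d : ℤ) • 𝟙 (Y s)) ∧
                ((ε s).hom ≫ fiberι f s) ≫ g = (Ψ s).hom.hom.hom ≫ ((ε s).hom ≫ fiberι f s)) ∧
              (∃ (ιb : Type) (_ : Fintype ιb) (_ : DecidableEq ιb)
                  (b : Module.Basis ιb ℂ (complexBetti (fiberOver f s₀) 1)) (Jℤ : Matrix ιb ιb ℤ)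
                  (n' : ℕ),
                3 ≤ n' ∧
                (∀ g₀ : fiberOver f s₀ ⟶ fiberOver f s₀, g₀ ≫ fiberι f s₀ = fiberι f s₀ ≫ g →
                  LinearMap.toMatrix b b (complexBetti.map g₀ 1).hom = Jℤ.map (Int.castRingHom ℂ)) ∧
                ∀ (hU : IsCohomologicallyLocallyTrivialOn f (Set.univ : Set (ComplexPoints S)))
                  (γ : Path.Homotopic.Quotient
                    (⟨s₀, Set.mem_univ s₀⟩ : (Set.univ : Set (ComplexPoints S))) ⟨s₀, Set.mem_univ s₀⟩),
                  ∃ Dℤ : Matrix ιb ιb ℤ,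
                    LinearMap.toMatrix b b (transportLinear f 1 hU γ :) =
                      (1 + (n' : ℤ) • Dℤ).map (Int.castRingHom ℂ)) ∧
              (∃ (m : ℕ) (hm : 1 ≤ m) (hPm : P.dim = m + 1) (hd : 0 < d) (hψ : ψ₀ ≫ ψ₀ = -(d • 𝟙 P))
                  (ω : complexBetti P.X (2 + 2 * m)) (hω : IsRationalClass ω) (hω0 : ω ≠ 0),
                ∀ (J : (weilDatumOfKsymm hm hPm hd hψ e ha ha0 hω hω0).Cx →ₗ[ℂ]
                    (weilDatumOfKsymm hm hPm hd hψ e ha ha0 hω hω0).Cx)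
                  (hW : Motives.IsWeilComplexStructure
                    (weilDatumOfKsymm hm hPm hd hψ e ha ha0 hω hω0).hForm J),
                  ∃ (s : ComplexPoints S) (β : bettiCohomology P.X 1 ≃ₗ[ℚ] bettiCohomology (Y s).X 1),
                    (∀ x, β (bettiCohomology.map ψ₀.hom.hom.hom 1 x) =
                      bettiCohomology.map (Ψ s).hom.hom.hom 1 (β x)) ∧
                    ∀ x ∈ ((weilDatumOfKsymm hm hPm hd hψ e ha ha0 hω hω0).hodgeStructure J hW.sq).piece 1 0,
                      IsOfHodgeType (2 * n) (Y s).X 1 1 0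
                        (Motives.ofRatClassBaseChange (ComplexPoints (Y s).X) 1
                          (β.toLinearMap.baseChange ℂ x))) ∧
              IsRationalClass a' ∧
              complexBetti.map e'.hom 2 (complexBetti.map (fiberι f s₀) 2
                (complexBetti.map
                  (ι ≫ CategoryTheory.CartesianMonoidalCategory.fst (projectiveSpace N ℂ) S) 2 a')) =
                (d : ℂ) • complexBetti.map e.ι 2 a +
                  complexBetti.map ψ₀.hom.hom.hom 2 (complexBetti.map e.ι 2 a)) :
    Summit.HodgeConjecture.HodgeConjecture.Theses.HeckePrymWeil.DeligneWeilFamily :=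
  deligneWeilFamilyDecl_iff_kAction.2
    (deligne1982_weilFamily_kAction_of_levelStructure
      (deligne1982_weilFamily_levelStructure_of_periodConstructionAtWeilType_only h))

/-- **The route decl `DeligneWeilFamily` (stmt-HodgeConjecture-16866) from the NAMED fact
`deligne1982_weilFamily_periodConstructionAtWeilType`** (rev. 2; the by-name sequel of
`deligneWeilFamily_of_periodConstructionAtWeilType`, whose displayed hypothesis IS that name's body): the item holds
CONDITIONALLY on exactly ONE named printed fact — Deligne's level-`n'` algebraic family `Γ∖B → Γ∖X⁺` with its
global `√-d`, abelian fibre charts, integral level structure, period surjectivity onto `X⁺` and one polarization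
class, through every polarized complex abelian `2n`-fold OF WEIL TYPE `(n, n)` ([Deligne1982HodgeCycles] proof of
Thm. 4.8, pp. 32–34, the family being built from the signature-`(n, n)` Hermitian data; van Geemen 5.3–5.5,
5.8–5.11 for every discriminant), typed as
`Literature.AlgebraicGeometry.HodgeTheory.deligne1982_weilFamily_periodConstructionAtWeilType` and UNPROVED in the tree
(no moduli of abelian varieties, no universal family, no Baily–Borel there); then M3, the flat Weil section and the
decl by name as in the preceding theorem. CONDITIONAL RESULT: nothing here proves any case of the Hodge conjecture;
HC / HC_CM / HC_AV are NOT proved.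
[cite: Deligne1982HodgeCycles, §4 Prop. 4.4 and proof of Thm. 4.8 (Milne's TeXed ed., rev. 2018, pp. 32–34; LNM 900 §4)]
[cite: vanGeemen1994HodgeAV, 4.9, 5.3–5.5 and 5.8–5.11] -/
theorem deligneWeilFamily_of_deligne1982_weilFamily_periodConstructionAtWeilType
    (hJ1 : deligne1982_weilFamily_periodConstructionAtWeilType) :
    Summit.HodgeConjecture.HodgeConjecture.Theses.HeckePrymWeil.DeligneWeilFamily :=
  deligneWeilFamily_of_periodConstructionAtWeilType hJ1

end Summit.HodgeConjecture.HodgeConjecture.Theorems.HeckePrymWeilLine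

end
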